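import Mathlib.Probability.Distributions.Gaussian.HasGaussianLaw.Independence
import Mathlib.Probability.Independence.Integration
import Summits.QuantumFields.BalabanUV.T4Continuum.Support.NE9GaussianSlice

/-!
# NE9TiltedProduct — completing the square with a LINEAR term, for a product of Gaussian fluctuation variables

The (SHELL) slice majorant of NE9-CUT (cell `pub-balaban`, T4-DAG §2 node U3 / §6 NE9; lineage t4-ne9-p1, generation 19;
census E26 of `t4/T4-EST-NE9-P1.md` §26) needs the Gaussian computation of [II] (2.23)–(2.24) with ALL of its structure:
after Bałaban's estimates (2.15)–(2.22) the fluctuation integral of one term (2.14) is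
`∫ dμ_{C^{(k)}(Z₀,0)}(B) exp(−⟨B, Γ_k X⟩ + ½α₅‖B‖²) (…)` — a Gaussian measure of GENERAL covariance, a QUADRATIC tilt and a
LINEAR term (a shift of the mean depending on the outer variable `X`).  `NE9GaussianSlice` (g18) certified the slice majorant
with the quadratic tilt on the diagonal model and the determinant formula (2.24) for any covariance; this module supplies the
two missing elementary pieces in the coordinates that diagonalise the covariance:

§1 ONE VARIABLE, quadratic + linear tilt, as an identity of MEASURES (completing the square):
   `e^{½βx² + γx}·𝒩(0,1) = (1 − β)^{−1/2} e^{γ²/(2(1−β))} · 𝒩(γ/(1−β), (1−β)⁻¹)` (`withDensity_quadLinTilt_gaussianReal`).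
§2 FINITE PRODUCTS: a product density against a product measure is the product of the tilted factors
   (`withDensity_pi_eq_pi_withDensity`, general), hence the tilted product standard Gaussian is the constant
   `Π_i (1 − β_i)^{−1/2} e^{γ_i²/(2(1−β_i))}` times the product Gaussian `⊗_i 𝒩(γ_i/(1−β_i), (1−β_i)⁻¹)` (`withDensity_tiltFun_pi`).
§3 A LINEAR FUNCTIONAL `w ↦ Σ_i c_i w_i` of the tilted product is Gaussian with variance `Σ_i c_i²(1−β_i)⁻¹` (Mathlib's
   `HasGaussianLaw` of independent Gaussians), so its SHELL `{a ≤ |Σ c_i w_i| < a′}` has mass `≤ 2(a′ − a)/√(2πΣ_i c_i²(1−β_i)⁻¹)`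
   (`tiltedPi_shell_le`) — density ≤ peak, LINEAR in the width.

`NE9TiltedShell` (same generation) assembles these in an orthonormal eigenbasis of the covariance into the slice majorant for
the full structure of (2.23).  HONEST FRAMING (T4-DAG PAGE 1): rung (B)+1 on a FIXED finite torus with `FlowStep.BetaPertH`
and (B) explicit — NOT infinite volume, NOT a mass gap, NOT the Clay problem; NE9 is a cell NEW ESTIMATE and is NOT
discharged here; this module is elementary Gaussian measure theory (`[folklore]`), [II] = [Balaban1988RG2Cluster] is quoted
for TYPES only (ABSOLUTE RULE).

References (TYPES only): [Balaban1988RG2Cluster] T. Bałaban, Renormalization group approach to lattice gauge field theories.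
II. Cluster expansions, CMP 116 (1988) 1–22: (2.14) p. 15, (2.23)–(2.26) p. 17.
-/

noncomputable section

namespace Summit.QuantumFields.BalabanUV.T4Continuum.NE9TiltedProduct

open MeasureTheory ProbabilityTheory Set
open scoped NNReal ENNReal BigOperators

/-! ## §1 One fluctuation variable: quadratic tilt WITH a linear term (completing the square) -/

/-- The tilted variance `(1 − β)⁻¹` (as `ℝ≥0`; meaningful for `β < 1`). [folklore] -/
def tiltVar (β : ℝ) : ℝ≥0 := ((1 - β)⁻¹).toNNReal

/-- The tilt normalisation `(1 − β)^{−1/2}·e^{γ²/(2(1 − β))}` — the total mass of `e^{½βx² + γx}·𝒩(0,1)`. [folklore] -/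
def tiltConst (β γ : ℝ) : ℝ := (Real.sqrt (1 - β))⁻¹ * Real.exp (γ ^ 2 / (2 * (1 - β)))

/-- For `β < 1` the tilted variance is the real number `(1 − β)⁻¹`. [folklore] -/
theorem coe_tiltVar {β : ℝ} (hβ : β < 1) : (tiltVar β : ℝ) = (1 - β)⁻¹ :=
  Real.coe_toNNReal _ (inv_nonneg.2 (by linarith))

/-- For `β < 1` the tilted variance is nonzero. [folklore] -/
theorem tiltVar_ne_zero {β : ℝ} (hβ : β < 1) : tiltVar β ≠ 0 := by
  have h : (0 : ℝ) < (tiltVar β : ℝ) := by rw [coe_tiltVar hβ]; exact inv_pos.2 (by linarith)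
  exact_mod_cast h.ne'

/-- The tilt normalisation is positive. [folklore] -/
theorem tiltConst_pos {β : ℝ} (hβ : β < 1) (γ : ℝ) : 0 < tiltConst β γ := by
  unfold tiltConst
  have h1 : 0 < 1 - β := by linarith
  have : 0 < Real.sqrt (1 - β) := Real.sqrt_pos.2 h1
  positivity

/-- COMPLETING THE SQUARE, pointwise: `p_{0,1}(x)·e^{½βx² + γx} = (1−β)^{−1/2}e^{γ²/(2(1−β))}·p_{γ/(1−β),(1−β)⁻¹}(x)`.
[folklore] -/
theorem gaussianPDFReal_mul_exp_quadLinTilt {β : ℝ} (hβ : β < 1) (γ x : ℝ) :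
    gaussianPDFReal 0 1 x * Real.exp (β / 2 * x ^ 2 + γ * x) =
      tiltConst β γ * gaussianPDFReal (γ / (1 - β)) (tiltVar β) x := by
  have h1 : 0 < 1 - β := by linarith
  have h1' : (1 - β) ≠ 0 := h1.ne'
  have hs : Real.sqrt (1 - β) ≠ 0 := (Real.sqrt_pos.2 h1).ne'
  have h2π : 0 < Real.sqrt (2 * Real.pi) := Real.sqrt_pos.2 (by positivity)
  rw [gaussianPDFReal, gaussianPDFReal, tiltConst, coe_tiltVar hβ]
  have hsq : Real.sqrt (2 * Real.pi * (1 - β)⁻¹) = Real.sqrt (2 * Real.pi) * (Real.sqrt (1 - β))⁻¹ := by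
    rw [Real.sqrt_mul (by positivity), Real.sqrt_inv]
  rw [hsq]
  simp only [NNReal.coe_one, mul_one, sub_zero]
  rw [mul_assoc, ← Real.exp_add, mul_inv, inv_inv]
  have hrhs : (Real.sqrt (1 - β))⁻¹ * Real.exp (γ ^ 2 / (2 * (1 - β))) *
      ((Real.sqrt (2 * Real.pi))⁻¹ * Real.sqrt (1 - β) * Real.exp (-(x - γ / (1 - β)) ^ 2 / (2 * (1 - β)⁻¹))) =
      (Real.sqrt (2 * Real.pi))⁻¹ * Real.exp (γ ^ 2 / (2 * (1 - β)) + -(x - γ / (1 - β)) ^ 2 / (2 * (1 - β)⁻¹)) := by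
    rw [Real.exp_add]; field_simp
  rw [hrhs]
  congr 1
  congr 1
  field_simp
  ring

/-- **COMPLETING THE SQUARE as an identity of measures**: for `β < 1`,
`e^{½βx² + γx}·𝒩(0,1) = (1 − β)^{−1/2}e^{γ²/(2(1−β))} · 𝒩(γ/(1−β), (1−β)⁻¹)` — quadratic tilt AND linear term (the mean
shift of [II] (2.23)'s `−⟨B, Γ_k X⟩`). [cite: Balaban1988RG2Cluster, (2.23)-(2.24) p.17] -/
theorem withDensity_quadLinTilt_gaussianReal {β : ℝ} (hβ : β < 1) (γ : ℝ) :
    (gaussianReal 0 1).withDensity (fun x => ENNReal.ofReal (Real.exp (β / 2 * x ^ 2 + γ * x))) =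
      (tiltConst β γ).toNNReal • gaussianReal (γ / (1 - β)) (tiltVar β) := by
  have hmeas : Measurable fun x : ℝ => ENNReal.ofReal (Real.exp (β / 2 * x ^ 2 + γ * x)) := by fun_prop
  rw [gaussianReal_of_var_ne_zero 0 one_ne_zero, gaussianReal_of_var_ne_zero _ (tiltVar_ne_zero hβ),
    ← withDensity_mul _ (measurable_gaussianPDF 0 1) hmeas, ← Measure.coe_nnreal_smul,
    ← withDensity_smul _ (measurable_gaussianPDF _ _)]
  congr 1
  funext x
  simp only [Pi.mul_apply, Pi.smul_apply, smul_eq_mul, gaussianPDF_def]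
  rw [← ENNReal.ofReal_mul (gaussianPDFReal_nonneg _ _ _), gaussianPDFReal_mul_exp_quadLinTilt hβ,
    ENNReal.ofReal_mul (tiltConst_pos hβ γ).le]
  rfl

/-! ## §2 Finite products: the tilted product standard Gaussian -/

section General

variable {ι : Type*} [Fintype ι] {α : ι → Type*} [∀ i, MeasurableSpace (α i)]

/-- A product of `ℝ≥0`-multiples is the product multiple of the product measure. [folklore] -/
theorem pi_smul_nnreal (ν : ∀ i, Measure (α i)) [∀ i, SigmaFinite (ν i)] (c : ι → ℝ≥0)
    [∀ i, SigmaFinite (c i • ν i)] : Measure.pi (fun i => c i • ν i) = (∏ i, c i) • Measure.pi ν := by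
  refine Measure.pi_eq fun s _ => ?_
  rw [Measure.smul_apply, Measure.pi_pi]
  simp only [Measure.smul_apply, ENNReal.smul_def, smul_eq_mul, ENNReal.ofNNReal_finsetProd]
  rw [Finset.prod_mul_distrib]

/-- **A PRODUCT DENSITY AGAINST A PRODUCT OF PROBABILITY MEASURES is the product of the tilted factors**:
`(⊗_i μ_i)·Π_i f_i(w_i) = ⊗_i (f_i·μ_i)` (boxes, independence of the coordinates, `Measure.pi_eq`). [folklore] -/
theorem withDensity_pi_eq_pi_withDensity (μ : ∀ i, Measure (α i)) [∀ i, IsProbabilityMeasure (μ i)]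
    (f : ∀ i, α i → ℝ≥0∞) (hf : ∀ i, Measurable (f i)) [∀ i, SigmaFinite ((μ i).withDensity (f i))] :
    (Measure.pi μ).withDensity (fun w => ∏ i, f i (w i)) = Measure.pi (fun i => (μ i).withDensity (f i)) := by
  refine (Measure.pi_eq fun s hs => ?_).symm
  rw [withDensity_apply _ (MeasurableSet.univ_pi hs), ← lintegral_indicator (MeasurableSet.univ_pi hs)]
  have hind : ∀ w : ∀ i, α i,
      (Set.univ.pi s).indicator (fun w => ∏ i, f i (w i)) w = ∏ i, (s i).indicator (f i) (w i) := by
    intro w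
    by_cases hw : w ∈ Set.univ.pi s
    · rw [indicator_of_mem hw]
      refine Finset.prod_congr rfl fun i _ => ?_
      rw [indicator_of_mem ((mem_univ_pi.1 hw) i)]
    · rw [indicator_of_notMem hw]
      obtain ⟨i, hi⟩ : ∃ i, w i ∉ s i := by simpa only [mem_univ_pi, not_forall] using hw
      exact (Finset.prod_eq_zero (Finset.mem_univ i) (by rw [indicator_of_notMem hi])).symm
  simp_rw [hind]
  have hprod := lintegral_prod_eq_prod_lintegral_of_indepFun (μ := Measure.pi μ) Finset.univ
    (fun i (w : ∀ j, α j) => (s i).indicator (f i) (w i))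
    (iIndepFun_pi (X := fun i => (s i).indicator (f i)) fun i => ((hf i).indicator (hs i)).aemeasurable)
    (fun i => ((hf i).indicator (hs i)).comp (measurable_pi_apply i))
  rw [hprod]
  refine Finset.prod_congr rfl fun i _ => ?_
  have h := (measurePreserving_eval μ i).lintegral_comp ((hf i).indicator (hs i))
  simp only [Function.eval] at h
  rw [h, lintegral_indicator (hs i), withDensity_apply _ (hs i)]

end General

variable {ι : Type*} [Fintype ι]

/-- The product tilt `Π_i e^{½β_i w_i² + γ_i w_i}` (real-valued). [folklore] -/
def tiltFun (β γ : ι → ℝ) (w : ι → ℝ) : ℝ := ∏ i, Real.exp (β i / 2 * (w i) ^ 2 + γ i * w i)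

/-- The tilted product Gaussian `⊗_i 𝒩(γ_i/(1−β_i), (1−β_i)⁻¹)`. [folklore] -/
def tiltedPi (β γ : ι → ℝ) : Measure (ι → ℝ) :=
  Measure.pi fun i => gaussianReal (γ i / (1 - β i)) (tiltVar (β i))

/-- The tilted product Gaussian is a probability measure. [folklore] -/
instance isProbabilityMeasure_tiltedPi (β γ : ι → ℝ) : IsProbabilityMeasure (tiltedPi β γ) := by
  unfold tiltedPi; infer_instance

/-- The product tilt is positive. [folklore] -/
theorem tiltFun_pos (β γ : ι → ℝ) (w : ι → ℝ) : 0 < tiltFun β γ w :=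
  Finset.prod_pos fun _ _ => Real.exp_pos _

/-- The product tilt is measurable. [folklore] -/
theorem measurable_tiltFun (β γ : ι → ℝ) : Measurable (tiltFun β γ) := by
  unfold tiltFun
  refine Finset.measurable_prod _ fun i _ => ?_
  fun_prop

/-- **THE TILTED PRODUCT STANDARD GAUSSIAN** (type of [II] (2.23)–(2.24) in diagonalising coordinates, WITH the linear term):
for `β_i < 1`, `Π_i e^{½β_i w_i² + γ_i w_i} · ⊗_i𝒩(0,1) = (Π_i (1−β_i)^{−1/2}e^{γ_i²/(2(1−β_i))}) · ⊗_i 𝒩(γ_i/(1−β_i), (1−β_i)⁻¹)`.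
[cite: Balaban1988RG2Cluster, (2.23)-(2.24) p.17] -/
theorem withDensity_tiltFun_pi {β : ι → ℝ} (hβ : ∀ i, β i < 1) (γ : ι → ℝ) :
    (Measure.pi fun _ : ι => gaussianReal 0 1).withDensity (fun w => ENNReal.ofReal (tiltFun β γ w)) =
      (∏ i, (tiltConst (β i) (γ i)).toNNReal) • tiltedPi β γ := by
  have h1 : (fun w : ι → ℝ => ENNReal.ofReal (tiltFun β γ w)) =
      fun w => ∏ i, ENNReal.ofReal (Real.exp (β i / 2 * (w i) ^ 2 + γ i * w i)) := by
    funext w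
    rw [tiltFun, ENNReal.ofReal_prod_of_nonneg (fun i _ => (Real.exp_pos _).le)]
  rw [h1, withDensity_pi_eq_pi_withDensity (fun _ : ι => gaussianReal 0 1)
    (fun i (x : ℝ) => ENNReal.ofReal (Real.exp (β i / 2 * x ^ 2 + γ i * x))) (fun i => by fun_prop)]
  have h2 : (fun i => (gaussianReal 0 1).withDensity
      (fun x : ℝ => ENNReal.ofReal (Real.exp (β i / 2 * x ^ 2 + γ i * x)))) =
      fun i => (tiltConst (β i) (γ i)).toNNReal • gaussianReal (γ i / (1 - β i)) (tiltVar (β i)) := by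
    funext i
    exact withDensity_quadLinTilt_gaussianReal (hβ i) (γ i)
  rw [h2, pi_smul_nnreal]
  rfl

/-- Integral form: for a nonnegative measurable `g`, `∫ g·tiltFun d⊗𝒩(0,1) = (Π_i tiltConst_i)·∫ g d(tiltedPi)` (as `ℝ≥0∞`
integrals). [folklore] -/
theorem lintegral_mul_tiltFun {β : ι → ℝ} (hβ : ∀ i, β i < 1) (γ : ι → ℝ) {g : (ι → ℝ) → ℝ≥0∞}
    (hg : Measurable g) :
    ∫⁻ w, g w * ENNReal.ofReal (tiltFun β γ w) ∂(Measure.pi fun _ : ι => gaussianReal 0 1) =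
      (∏ i, (tiltConst (β i) (γ i)).toNNReal) * ∫⁻ w, g w ∂(tiltedPi β γ) := by
  have hmeas : Measurable fun w : ι → ℝ => ENNReal.ofReal (tiltFun β γ w) :=
    (measurable_tiltFun β γ).ennreal_ofReal
  have hfg : (fun w : ι → ℝ => g w * ENNReal.ofReal (tiltFun β γ w)) =
      (fun w : ι → ℝ => ENNReal.ofReal (tiltFun β γ w)) * g := by
    funext w; simp only [Pi.mul_apply, mul_comm]
  rw [hfg, ← lintegral_withDensity_eq_lintegral_mul _ hmeas hg, withDensity_tiltFun_pi hβ γ,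
    lintegral_smul_measure]
  rfl

/-! ## §3 A linear functional of the tilted product: Gaussian law, variance, shell -/

/-- Each scaled coordinate `w ↦ c_i w_i` is Gaussian under the tilted product. [folklore] -/
theorem hasGaussianLaw_coord_mul (β γ : ι → ℝ) (c : ι → ℝ) (i : ι) :
    HasGaussianLaw (fun w : ι → ℝ => c i * w i) (tiltedPi β γ) := by
  have : IsGaussian ((tiltedPi β γ).map (fun w : ι → ℝ => c i * w i)) := by
    rw [show (fun w : ι → ℝ => c i * w i) = (fun x : ℝ => c i * x) ∘ Function.eval i from rfl,
      ← Measure.map_map (by fun_prop) (by fun_prop), tiltedPi,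
      (measurePreserving_eval _ i).map_eq, gaussianReal_map_const_mul]
    infer_instance
  exact IsGaussian.hasGaussianLaw

/-- **A LINEAR FUNCTIONAL OF THE TILTED PRODUCT IS GAUSSIAN** (independent Gaussian coordinates). [folklore] -/
theorem hasGaussianLaw_linear (β γ : ι → ℝ) (c : ι → ℝ) :
    HasGaussianLaw (fun w : ι → ℝ => ∑ i, c i * w i) (tiltedPi β γ) := by
  have hind : iIndepFun (fun i (w : ι → ℝ) => c i * w i) (tiltedPi β γ) := by
    unfold tiltedPi
    exact iIndepFun_pi (X := fun i (x : ℝ) => c i * x) fun i => by fun_prop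
  exact hind.hasGaussianLaw_fun_sum (hasGaussianLaw_coord_mul β γ c)

/-- The variance of the linear functional: `Var[Σ_i c_i w_i] = Σ_i c_i²(1−β_i)⁻¹`. [folklore] -/
theorem variance_linear {β : ι → ℝ} (hβ : ∀ i, β i < 1) (γ : ι → ℝ) (c : ι → ℝ) :
    Var[fun w : ι → ℝ => ∑ i, c i * w i; tiltedPi β γ] = ∑ i, c i ^ 2 * (1 - β i)⁻¹ := by
  have hfun : (fun w : ι → ℝ => ∑ i, c i * w i) = ∑ i, fun w : ι → ℝ => c i * w i := by
    funext w; simp only [Finset.sum_apply]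
  rw [hfun, tiltedPi, variance_sum_pi (X := fun i (x : ℝ) => c i * x)]
  · refine Finset.sum_congr rfl fun i _ => ?_
    rw [show (fun x : ℝ => c i * x) = fun x => c i * id x from rfl, variance_const_mul, variance_id_gaussianReal,
      coe_tiltVar (hβ i)]
  · intro i
    exact IsGaussian.memLp_two_id.const_mul (c i)

/-- **THE SHELL OF A LINEAR FUNCTIONAL under the tilted product**: for `a ≤ a′` and `V = Σ_i c_i²(1−β_i)⁻¹ > 0`,
`tiltedPi{a ≤ |Σ c_i w_i| < a′} ≤ 2(a′ − a)/√(2πV)` — the law is `𝒩(·, V)` and its density is at most the peak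
`(2πV)^{−1/2}`; LINEAR in the width. [cite: Balaban1988RG2Cluster, (2.3) p.12 and (2.23) p.17] -/
theorem tiltedPi_shell_le {β : ι → ℝ} (hβ : ∀ i, β i < 1) (γ : ι → ℝ) (c : ι → ℝ) {a a' : ℝ} (haa' : a ≤ a')
    (hV : 0 < ∑ i, c i ^ 2 * (1 - β i)⁻¹) :
    tiltedPi β γ {w : ι → ℝ | a ≤ |∑ i, c i * w i| ∧ |∑ i, c i * w i| < a'} ≤
      ENNReal.ofReal (2 * (a' - a) * (Real.sqrt (2 * Real.pi * ∑ i, c i ^ 2 * (1 - β i)⁻¹))⁻¹) := by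
  have hlaw := (hasGaussianLaw_linear β γ c).map_eq_gaussianReal
  rw [variance_linear hβ γ c] at hlaw
  have hset : {w : ι → ℝ | a ≤ |∑ i, c i * w i| ∧ |∑ i, c i * w i| < a'} =
      (fun w : ι → ℝ => ∑ i, c i * w i) ⁻¹' {y : ℝ | a ≤ |y| ∧ |y| < a'} := rfl
  have hmeas : Measurable fun w : ι → ℝ => ∑ i, c i * w i := by fun_prop
  rw [hset, ← Measure.map_apply hmeas (Literature.Analysis.Fourier.measurableSet_annulus a a'), hlaw]
  have hv : (∑ i, c i ^ 2 * (1 - β i)⁻¹).toNNReal ≠ 0 := by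
    rw [ne_eq, Real.toNNReal_eq_zero, not_le]; exact hV
  have h := NE9GaussianSlice.gaussianReal_shell_le_mean (∫ w, ∑ i, c i * w i ∂tiltedPi β γ) hv haa'
  rwa [Real.coe_toNNReal _ hV.le] at h

/-- **THE SHELL AGAINST THE TILTED DENSITY** (the form used by `NE9TiltedShell`): for `β_i < 1`, `a ≤ a′`, `V > 0` and any
real `M` (the indicator of the shell times the constant `M`),
`∫⁻ G·tiltFun d⊗𝒩(0,1) ≤ M · (Π_i tiltConst_i) · 2(a′−a)/√(2πV)`. [folklore] -/
theorem lintegral_shell_tiltFun_le {β : ι → ℝ} (hβ : ∀ i, β i < 1) (γ : ι → ℝ) (c : ι → ℝ) {a a' : ℝ}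
    (haa' : a ≤ a') (hV : 0 < ∑ i, c i ^ 2 * (1 - β i)⁻¹) (M : ℝ) :
    ∫⁻ w, {w : ι → ℝ | a ≤ |∑ i, c i * w i| ∧ |∑ i, c i * w i| < a'}.indicator (fun _ => ENNReal.ofReal M) w *
        ENNReal.ofReal (tiltFun β γ w) ∂(Measure.pi fun _ : ι => gaussianReal 0 1) ≤
      ENNReal.ofReal M * (∏ i, (tiltConst (β i) (γ i)).toNNReal) *
        ENNReal.ofReal (2 * (a' - a) * (Real.sqrt (2 * Real.pi * ∑ i, c i ^ 2 * (1 - β i)⁻¹))⁻¹) := by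
  set S : Set (ι → ℝ) := {w : ι → ℝ | a ≤ |∑ i, c i * w i| ∧ |∑ i, c i * w i| < a'} with hS
  have hmeasS : MeasurableSet S := by
    have hmeas : Measurable fun w : ι → ℝ => ∑ i, c i * w i := by fun_prop
    exact hmeas (Literature.Analysis.Fourier.measurableSet_annulus a a')
  have hg : Measurable (S.indicator fun _ : ι → ℝ => ENNReal.ofReal M) := measurable_const.indicator hmeasS
  rw [lintegral_mul_tiltFun hβ γ hg, lintegral_indicator hmeasS, setLIntegral_const, mul_comm (ENNReal.ofReal M),
    ← mul_assoc, mul_comm _ (ENNReal.ofReal M), mul_assoc]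
  gcongr
  exact tiltedPi_shell_le hβ γ c haa' hV

end Summit.QuantumFields.BalabanUV.T4Continuum.NE9TiltedProduct

end
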